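import Mathlib
import HarnessLib
import Literature.Analysis.FluidPDE.TypeIAncientMild
import Literature.Analysis.FluidPDE.LocalTypeI
import Summits.NavierStokesRegularity.NavierStokesRegularity.Theorems.PoloidalWindowDoorPoloidalWindowRigidityWindow
import Summits.NavierStokesRegularity.NavierStokesRegularity.Theorems.PoloidalWindowDoorPoloidalWindowRigidityFlat
import Summits.NavierStokesRegularity.NavierStokesRegularity.Theorems.PoloidalWindowDoorPoloidalWindowRigidityPoloidalExtremalSelfRecurrent

/-!
# Route `PoloidalWindowDoor`, crux `PoloidalWindowRigidity` (K2, stmt-NavierStokesRegularity-19708) —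
# REDUCTION of the poloidal Type-I Liouville problem to extremal self-recurrent profiles

Cell ns-regularity-ideate, K2 lead ns-poloidal-K2-p1 (support file, `--supports stmt-…-19708 --as helper`; closes the H1 programme:
p469616 · p470378 · p470559 · p471740 · p472559 · p473325).

`poloidal_rigidity_of_no_extremal_recurrent`: to prove the residue S2′ of line `slicesharp-screw` in its raw form «Type-I rate +
continuity + Oseen–Duhamel identity + divergence-free + poloidal + frozen ⇒ no backward singularity at the apex», it SUFFICES to show that
no profile `W` exists which is (a) in a KNSS class `𝔓(C⋆)`, `C⋆ > 0`, poloidal and frozen, (b) EXTREMAL in the sub-class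
(`‖W(−1,0)‖ = C⋆`, hot-spot bound `√(−t)‖W(t,x)‖ ≤ ‖W(−1,0)‖`, `C⋆` minimal among the constants of nontrivial poloidal frozen
elements) and (c) RECURRENT under blow-down modulo translations.  (If `v` is trivial it is not singular — `not_backwardSingular_of_zero`;
otherwise `exists_selfRecurrent_poloidal_extremal` produces such a `W`.)  A rev-8 skeleton may therefore state the residue about `W`
and compose through this lemma; the nondegeneracy clauses of S2′ transfer to `W` only through the settled strata (each turns a
degenerate `W` into `W ≡ 0`, contradicting `‖W(−1,0)‖ = C⋆ > 0`), which is the lead's bookkeeping, not this file's.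

WHAT THIS IS NOT: not a claim about Navier–Stokes regularity and not the residue — a reduction (bears_on LADDER-NS N0,
rung N0-LocalTubeDoorPoloidal).
-/

noncomputable section

-- the summit and its single sub-problem share the name (CONVENTIONS §1), as in every Theorems file
set_option linter.dupNamespace false

namespace Summit.NavierStokesRegularity.NavierStokesRegularity.Theorems.PoloidalWindowDoorPoloidalWindowRigidityPoloidalExtremalReduction

open MeasureTheory Set Function Filter Topology
open scoped RealInnerProductSpace InnerProductSpace
open Literature.Analysis Literature.Analysis.FluidPDE
open Summit.NavierStokesRegularity.NavierStokesRegularity.Theorems.PoloidalWindowDoorPoloidalWindowRigidityWindow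
open Summit.NavierStokesRegularity.NavierStokesRegularity.Theorems.PoloidalWindowDoorPoloidalWindowRigidityFlat
open Summit.NavierStokesRegularity.NavierStokesRegularity.Theorems.PoloidalWindowDoorPoloidalWindowRigidityPoloidalExtremalSelfRecurrent

/-- **Reduction to extremal self-recurrent profiles.**  If no poloidal frozen profile is simultaneously extremal in the sub-class (with the
hot-spot bound and sub-class minimality of its constant) and recurrent under blow-down modulo translations, then every poloidal frozen
element of the Type-I Oseen-mild class is backward-regular at the apex. -/
theorem poloidal_rigidity_of_no_extremal_recurrent
    (hno : ∀ (Cs : ℝ) (W : ℝ → EuclideanSpace ℝ (Fin 3) → EuclideanSpace ℝ (Fin 3)), 0 < Cs → IsTypeIAncientMild Cs W →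
      (∀ s < 0, ∀ y, ⟪curl (W s) y, EuclideanSpace.single 2 (1 : ℝ)⟫_ℝ = 0) →
      (∀ s < 0, ∀ y, ⟪fderiv ℝ (W s) y (curl (W s) y), EuclideanSpace.single 2 (1 : ℝ)⟫_ℝ = 0) →
      ‖W (-1) 0‖ = Cs →
      (∀ t < 0, ∀ x, Real.sqrt (-t) * ‖W t x‖ ≤ ‖W (-1) 0‖) →
      (∀ (C' : ℝ) (u' : ℝ → EuclideanSpace ℝ (Fin 3) → EuclideanSpace ℝ (Fin 3)), IsTypeIAncientMild C' u' →
        (∀ s < 0, ∀ y, ⟪curl (u' s) y, EuclideanSpace.single 2 (1 : ℝ)⟫_ℝ = 0) →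
        (∀ s < 0, ∀ y, ⟪fderiv ℝ (u' s) y (curl (u' s) y), EuclideanSpace.single 2 (1 : ℝ)⟫_ℝ = 0) →
        (∃ t < 0, ∃ x, u' t x ≠ 0) → Cs ≤ C') →
      (∃ (lam : ℕ → ℝ) (xs : ℕ → EuclideanSpace ℝ (Fin 3)), (∀ j, 0 < lam j) ∧ Tendsto lam atTop atTop ∧
        ∀ t < (0 : ℝ), ∀ x, Tendsto (fun j => lam j • W (lam j ^ 2 * t) (xs j + lam j • x)) atTop (𝓝 (W t x))) →
      False) :
    ∀ (C : ℝ) (v : ℝ → EuclideanSpace ℝ (Fin 3) → EuclideanSpace ℝ (Fin 3)),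
      HasTypeITimeDecay C v → ContinuousOn (uncurry v) (Iio (0 : ℝ) ×ˢ univ) →
      (∀ s t : ℝ, s < t → t < 0 → ∀ x,
        v t x = UnboundedOperators.heatExtension (v s) (t - s) x - oseenDuhamel 1 s v v t x) →
      (∀ t < 0, VectorCalculus.IsDivFree (v t)) →
      (∀ s < 0, ∀ y, ⟪curl (v s) y, EuclideanSpace.single 2 (1 : ℝ)⟫_ℝ = 0) →
      (∀ s < 0, ∀ y, ⟪fderiv ℝ (v s) y (curl (v s) y), EuclideanSpace.single 2 (1 : ℝ)⟫_ℝ = 0) →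
      ¬ IsBackwardSingularPoint v 0 := by
  intro C v hrate hcont hmild hdiv hpol hfro
  by_cases hzero : ∀ t < (0 : ℝ), ∀ y, v t y = 0
  · exact not_backwardSingular_of_zero hzero
  · push Not at hzero
    obtain ⟨t, ht, y, hy⟩ := hzero
    have hA : IsTypeIAncientMild C v := isTypeIAncientMild_of_class hrate hcont hmild hdiv
    obtain ⟨Cs, W, hCs, hW, hWp, hWf, hWn, hhot, hmin, hrec⟩ :=
      exists_selfRecurrent_poloidal_extremal ⟨C, v, hA, hpol, hfro, t, ht, y, hy⟩
    exact (hno Cs W hCs hW hWp hWf hWn hhot hmin hrec).elim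

end Summit.NavierStokesRegularity.NavierStokesRegularity.Theorems.PoloidalWindowDoorPoloidalWindowRigidityPoloidalExtremalReduction
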